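import Summits.AtomisticToContinuum.FouriersLaw.Theorems.OddSectorIrreversibilityTapLeakBoundSplitGlue
import Literature.MathematicalPhysics.KineticTheory.MomentumHermiteLadder

/-!
# `TapLeakBound` (stmt-AtomisticToContinuum-15159), line `SketchIdeator2`, stub `stub_massiveTap`

Helper file (`--supports stmt-AtomisticToContinuum-15159`; proves the registered stub `stub_massiveTap`)
for crux P = `Summit.AtomisticToContinuum.FouriersLaw.Theses.OddSectorIrreversibility.TapLeakBound`
(route `OddSectorIrreversibility`, sub-problem `FouriersLaw`).

**The massive tap identity at fixed `N`, as an inequality.** Write the equal-temperature generator as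
`L = X_H + γ S_B` (`generator_eq_liouvilleOp_add`; `X_H = Σ_i (p_i ∂_{q_i} − ∂_{q_i}H ∂_{p_i})`,
`S_B = Σ_i B_i (T ∂²_{p_i} − p_i ∂_{p_i})`, `B = bathWeight`). For `u ∈ C³` the momentum derivative
`∂_{p_b}` commutes through `L` up to two first-order terms (Schwarz):
`∂_{p_b}(X_H u) = X_H(∂_{p_b} u) + ∂_{q_b} u` (`hasDerivAt_liouvilleOp_line`) and
`∂_{p_b}(S_B u) = S_B(∂_{p_b} u) − B_b ∂_{p_b} u` (`hasDerivAt_bathOp_line`), whence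
`∂_{p_b}(L u) = L(∂_{p_b}u) + ∂_{q_b}u − γ B_b ∂_{p_b}u` (`partialP_generator`). So for a smooth
classical solution of `L u = −J` the tap derivative `v = ∂_{p_b} u` solves the Poisson equation
`L v = −k`, `k = ∂_{p_b}J + ∂_{q_b}u − γ B_b v`, and the landed tap energy identity
`integral_mul_source_eq_dirichlet` for the pair `(v, k)` gives
`⟨v, ∂_{p_b}J⟩ + ⟨v, ∂_{q_b}u⟩ − γ B_b ‖v‖² = γ T Σ_i B_i ‖∂_{p_i} v‖² ≥ γ T ‖∂²_{p_b} u‖²` at a contact `b`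
(`B_b ≥ 1`), together with `∂²_{p_b} u ∈ L²(μ_T)` (`memLp_partialP_of_poisson`). This is
`stub_massiveTap`. References: folklore (Eckmann–Pillet–Rey-Bellet 1999 §3 for the Dirichlet form).
-/

noncomputable section

open MeasureTheory ProbabilityTheory Filter Topology Set Function
open scoped NNReal ENNReal ContDiff

namespace Summit.AtomisticToContinuum.FouriersLaw.Theorems.OddSectorIrreversibility.TapLeak

open Literature.MathematicalPhysics.KineticTheory.HeatConduction
open Literature.MathematicalPhysics.KineticTheory
open Summit.AtomisticToContinuum.FouriersLaw.Theorems.OddSectorWitness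
open Summit.AtomisticToContinuum.FouriersLaw.Theorems.OddSectorIrreversibility.Corrector
open Summit.AtomisticToContinuum.FouriersLaw.Theorems.SuperadditiveResistance.DeviceLiouville

/-! ### Pointwise calculus: `∂_{p_b}` through the generator -/

section Calculus

variable {N : ℕ}

/-- Schwarz in two momenta: `∂_{p_i} ∂_{p_j} f = ∂_{p_j} ∂_{p_i} f` for `f ∈ C²`. [folklore] -/
theorem partialP_partialP_comm {f : PhaseSpace N → ℝ} (hf : ContDiff ℝ 2 f) (i j : Fin N)
    (x : PhaseSpace N) : partialP i (partialP j f) x = partialP j (partialP i f) x := by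
  -- adapted from `partialP_partialQ_comm` (MomentumHermiteLadder)
  have hfd : Differentiable ℝ f := hf.differentiable two_ne_zero
  have hP : ∀ k : Fin N, partialP k f = fun y => fderiv ℝ f y ((0, Pi.single k 1) : PhaseSpace N) :=
    fun k => partialP_eq_fderiv hfd k
  have hdP : ∀ k : Fin N, Differentiable ℝ (partialP k f) := fun k => by
    rw [hP k]; exact fun y => (hasFDerivAt_fderiv_apply hf y _).differentiableAt
  rw [partialP_eq_fderiv (hdP j), partialP_eq_fderiv (hdP i)]
  simp only [hP]
  rw [(hasFDerivAt_fderiv_apply hf x _).fderiv, (hasFDerivAt_fderiv_apply hf x _).fderiv]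
  simp only [ContinuousLinearMap.flip_apply]
  exact fderiv_fderiv_symm hf x _ _

/-- `∂_{p_b}(-f) = -∂_{p_b} f` (unconditionally). [folklore] -/
theorem partialP_neg_apply (b : Fin N) (f : PhaseSpace N → ℝ) (x : PhaseSpace N) :
    partialP b (fun y => -f y) x = -partialP b f x := by
  unfold partialP
  rw [← deriv.neg]
  rfl

/-- The derivative of the `i`-th coordinate along the `p_b`-line is `δ_{ib}`. [folklore] -/
theorem hasDerivAt_update_coord (p : Fin N → ℝ) (b i : Fin N) (t : ℝ) :
    HasDerivAt (fun s => Function.update p b s i) (if i = b then 1 else 0) t := by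
  have h := (hasDerivAt_pi.1 (hasDerivAt_update p b t)) i
  simpa [Pi.single_apply] using h

/-- A differentiable `G` restricted to the `p_b`-line through `x` has derivative `∂_{p_b} G (x)` at the
base point. [folklore] -/
theorem hasDerivAt_momentumLine {G : PhaseSpace N → ℝ} (hG : Differentiable ℝ G) (b : Fin N)
    (x : PhaseSpace N) :
    HasDerivAt (fun s => G (x.1, Function.update x.2 b s)) (partialP b G x) (x.2 b) := by
  have hl : Differentiable ℝ (fun s : ℝ => ((x.1, Function.update x.2 b s) : PhaseSpace N)) :=
    fun s => ((hasDerivAt_const s x.1).prodMk (hasDerivAt_update x.2 b s)).differentiableAt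
  exact ((hG.comp hl) (x.2 b)).hasDerivAt

/-- **`∂_{p_b}` through the Liouville operator** (`u ∈ C²`, `C²` potentials):
along the `p_b`-line, `X_H u` has derivative `X_H(∂_{p_b} u) + ∂_{q_b} u` — the commutator
`[∂_{p_b}, X_H] = ∂_{q_b}` (`∂_{p_b} p_i = δ_{ib}`, `∂_{p_b}∂_{q_i}H = 0`, Schwarz). [folklore] -/
theorem hasDerivAt_liouvilleOp_line (P : OscillatorChain) (hU : ContDiff ℝ 2 P.U)
    (hV : ContDiff ℝ 2 P.V) {u : PhaseSpace N → ℝ} (hu : ContDiff ℝ 2 u) (b : Fin N)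
    (x : PhaseSpace N) :
    HasDerivAt (fun s => liouvilleOp P N u (x.1, Function.update x.2 b s))
      (liouvilleOp P N (partialP b u) x + partialQ b u x) (x.2 b) := by
  have hQd : ∀ i, Differentiable ℝ (partialQ i u) := fun i =>
    (HeatConduction.contDiff_partialQ hu (m := 1) (by norm_num) i).differentiable one_ne_zero
  have hPd : ∀ i, Differentiable ℝ (partialP i u) := fun i =>
    (contDiff_partialP hu (m := 1) (by norm_num) i).differentiable one_ne_zero
  have hH : ContDiff ℝ 2 (P.hamiltonian N) := P.contDiff_hamiltonian hU hV N
  have hHQd : ∀ i, Differentiable ℝ (partialQ i (P.hamiltonian N)) := fun i =>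
    (HeatConduction.contDiff_partialQ hH (m := 1) (by norm_num) i).differentiable one_ne_zero
  -- `∂_{p_b} ∂_{q_i} H = 0`: `∂_{q_i} H` is a function of the positions
  have hHQP : ∀ i, partialP b (partialQ i (P.hamiltonian N)) x = 0 := fun i => by
    simp [partialP, OscillatorChain.partialQ_hamiltonian_eq]
  have hsum : HasDerivAt (fun s => liouvilleOp P N u (x.1, Function.update x.2 b s))
      (∑ i, (((if i = b then 1 else 0) * partialQ i u x + x.2 i * partialP b (partialQ i u) x) -
        (partialP b (partialQ i (P.hamiltonian N)) x * partialP i u x +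
          partialQ i (P.hamiltonian N) x * partialP b (partialP i u) x))) (x.2 b) := by
    unfold liouvilleOp
    refine HasDerivAt.fun_sum fun i _ => ?_
    refine (((hasDerivAt_update_coord x.2 b i (x.2 b)).fun_mul (hasDerivAt_momentumLine (hQd i) b x)).fun_sub
      ((hasDerivAt_momentumLine (hHQd i) b x).fun_mul (hasDerivAt_momentumLine (hPd i) b x))).congr_deriv ?_
    simp only [Function.update_eq_self, Prod.mk.eta]
  refine hsum.congr_deriv ?_
  have e2 : ∀ i ∈ (Finset.univ : Finset (Fin N)),
      (((if i = b then 1 else 0) * partialQ i u x + x.2 i * partialP b (partialQ i u) x) -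
        (partialP b (partialQ i (P.hamiltonian N)) x * partialP i u x +
          partialQ i (P.hamiltonian N) x * partialP b (partialP i u) x)) =
      (x.2 i * partialQ i (partialP b u) x - partialQ i (P.hamiltonian N) x * partialP i (partialP b u) x) +
        (if i = b then partialQ i u x else 0) := by
    intro i _
    rw [hHQP i, partialP_partialQ_comm hu b i x, partialP_partialP_comm hu b i x]
    split_ifs <;> ring
  rw [Finset.sum_congr rfl e2, Finset.sum_add_distrib, Finset.sum_ite_eq' Finset.univ b,
    if_pos (Finset.mem_univ b)]
  rfl

/-- **`∂_{p_b}` through the thermostat** (`u ∈ C³`): along the `p_b`-line, `S_B u` has derivative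
`S_B(∂_{p_b} u) − B_b ∂_{p_b} u` — the commutator `[∂_{p_b}, S_B] = −B_b ∂_{p_b}`
(`∂_{p_b}(p_i ∂_{p_i} u) = δ_{ib} ∂_{p_b} u + p_i ∂_{p_i}∂_{p_b} u`, Schwarz twice for the second-order
term). [folklore] -/
theorem hasDerivAt_bathOp_line {u : PhaseSpace N → ℝ} (hu : ContDiff ℝ 3 u) (B : Fin N → ℝ) (T : ℝ)
    (b : Fin N) (x : PhaseSpace N) :
    HasDerivAt (fun s => bathOp N B T u (x.1, Function.update x.2 b s))
      (bathOp N B T (partialP b u) x - B b * partialP b u x) (x.2 b) := by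
  have hu2 : ContDiff ℝ 2 u := hu.of_le (by norm_num)
  have hP2 : ∀ i, ContDiff ℝ 2 (partialP i u) := fun i => contDiff_partialP hu (m := 2) (by norm_num) i
  have hPd : ∀ i, Differentiable ℝ (partialP i u) := fun i => (hP2 i).differentiable two_ne_zero
  have hPPd : ∀ i, Differentiable ℝ (partialP i (partialP i u)) := fun i =>
    (contDiff_partialP (hP2 i) (m := 1) (by norm_num) i).differentiable one_ne_zero
  -- third-order Schwarz: `∂_b ∂_i ∂_i u = ∂_i ∂_i ∂_b u`
  have h3 : ∀ i, partialP b (partialP i (partialP i u)) x = partialP i (partialP i (partialP b u)) x :=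
    fun i => by
    rw [partialP_partialP_comm (hP2 i) b i x]
    have e : partialP b (partialP i u) = partialP i (partialP b u) :=
      funext fun y => partialP_partialP_comm hu2 b i y
    rw [e]
  have hsum : HasDerivAt (fun s => bathOp N B T u (x.1, Function.update x.2 b s))
      (∑ i, B i * (T * partialP b (partialP i (partialP i u)) x -
        ((if i = b then 1 else 0) * partialP i u x + x.2 i * partialP b (partialP i u) x))) (x.2 b) := by
    unfold bathOp
    refine HasDerivAt.fun_sum fun i _ => ?_
    refine ((((hasDerivAt_momentumLine (hPPd i) b x).const_mul T).fun_sub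
      ((hasDerivAt_update_coord x.2 b i (x.2 b)).fun_mul (hasDerivAt_momentumLine (hPd i) b x))).const_mul
        (B i)).congr_deriv ?_
    simp only [Function.update_eq_self, Prod.mk.eta]
  refine hsum.congr_deriv ?_
  have e2 : ∀ i ∈ (Finset.univ : Finset (Fin N)),
      B i * (T * partialP b (partialP i (partialP i u)) x -
        ((if i = b then 1 else 0) * partialP i u x + x.2 i * partialP b (partialP i u) x)) =
      B i * (T * partialP i (partialP i (partialP b u)) x - x.2 i * partialP i (partialP b u) x) -
        (if i = b then B i * partialP i u x else 0) := by
    intro i _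
    rw [h3 i, partialP_partialP_comm hu2 b i x]
    split_ifs <;> ring
  rw [Finset.sum_congr rfl e2, Finset.sum_sub_distrib, Finset.sum_ite_eq' Finset.univ b,
    if_pos (Finset.mem_univ b)]
  rfl

/-- **`∂_{p_b}` through the equal-temperature generator** (`u ∈ C³`, `C²` potentials):
`∂_{p_b}(L u) = L(∂_{p_b} u) + ∂_{q_b} u − γ B_b ∂_{p_b} u`, `B = bathWeight`. [folklore] -/
theorem partialP_generator (P : OscillatorChain) (hU : ContDiff ℝ 2 P.U) (hV : ContDiff ℝ 2 P.V)
    {u : PhaseSpace N → ℝ} (hu : ContDiff ℝ 3 u) (T : ℝ) (b : Fin N) (x : PhaseSpace N) :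
    partialP b (P.generator N T T u) x =
      P.generator N T T (partialP b u) x + partialQ b u x -
        P.γ * OscillatorChain.bathWeight N b * partialP b u x := by
  have hu2 : ContDiff ℝ 2 u := hu.of_le (by norm_num)
  have eG : (fun s => P.generator N T T u (x.1, Function.update x.2 b s)) = fun s =>
      liouvilleOp P N u (x.1, Function.update x.2 b s) +
        P.γ * bathOp N (OscillatorChain.bathWeight N) T u (x.1, Function.update x.2 b s) :=
    funext fun s => generator_eq_liouvilleOp_add P N T u _
  have h : HasDerivAt (fun s => P.generator N T T u (x.1, Function.update x.2 b s))
      (liouvilleOp P N (partialP b u) x + partialQ b u x +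
        P.γ * (bathOp N (OscillatorChain.bathWeight N) T (partialP b u) x -
          OscillatorChain.bathWeight N b * partialP b u x)) (x.2 b) := by
    rw [eG]
    exact (hasDerivAt_liouvilleOp_line P hU hV hu2 b x).fun_add
      ((hasDerivAt_bathOp_line hu _ T b x).const_mul P.γ)
  have e1 : partialP b (P.generator N T T u) x = _ := h.deriv
  rw [e1, generator_eq_liouvilleOp_add P N T (partialP b u) x]
  ring

end Calculus

/-! ### The massive tap identity -/

section Massive

variable {ω₂ lam β γ : ℝ} (hω : 0 < ω₂) (hl : 0 ≤ lam) (hβ : 0 ≤ β) (hγ : 0 < γ) {T : ℝ} (hT : 0 < T)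
  {N : ℕ}

include hω hl hβ hγ hT

/-- **The massive tap identity (fixed `N`), as an inequality.** For a smooth classical solution `u` of
`L_{T,T} u = −J` with `u, ∂_{q_b} u, ∂_{p_b} J ∈ L²(μ_T)` at a contact `b`: `∂²_{p_b} u ∈ L²(μ_T)` and
`γ T ‖∂²_{p_b} u‖² ≤ ⟨∂_{p_b} u, ∂_{p_b} J⟩ + ⟨∂_{p_b} u, ∂_{q_b} u⟩` (all in `L²(μ_T)`, `μ_T` the unnormalised
Gibbs weight). Proof: `v = ∂_{p_b} u` solves `L v = −(∂_{p_b}J + ∂_{q_b}u − γ B_b v)`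
(`partialP_generator`); apply `memLp_partialP_of_poisson` and `integral_mul_source_eq_dirichlet` to
this pair and drop `γ B_b ‖v‖² ≥ 0` and the bath terms `i ≠ b`. [folklore] -/
theorem massiveTap (b : Fin N) (hb : b.val = 0 ∨ b.val = N - 1) {u : PhaseSpace N → ℝ}
    (hu : ContDiff ℝ ∞ u)
    (hpde : ∀ x, (pinnedChain ω₂ lam β γ).generator N T T u x =
      -(∑ k : Fin N, (pinnedChain ω₂ lam β γ).bondCurrent N k x))
    (hu2 : MemLp u 2 (gibbsWeight ω₂ lam β γ N T))
    (hqu2 : MemLp (partialQ b u) 2 (gibbsWeight ω₂ lam β γ N T))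
    (hdJ2 : MemLp (partialP b (fun z : PhaseSpace N => ∑ k : Fin N, (pinnedChain ω₂ lam β γ).bondCurrent N k z)) 2
      (gibbsWeight ω₂ lam β γ N T)) :
    MemLp (partialP b (partialP b u)) 2 (gibbsWeight ω₂ lam β γ N T) ∧
    γ * T * ∫ x, (partialP b (partialP b u) x) ^ 2 ∂(gibbsWeight ω₂ lam β γ N T) ≤
      (∫ x, partialP b u x *
          partialP b (fun z : PhaseSpace N => ∑ k : Fin N, (pinnedChain ω₂ lam β γ).bondCurrent N k z) x
          ∂(gibbsWeight ω₂ lam β γ N T)) +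
        ∫ x, partialP b u x * partialQ b u x ∂(gibbsWeight ω₂ lam β γ N T) := by
  set P := pinnedChain ω₂ lam β γ with hP
  set μ := gibbsWeight ω₂ lam β γ N T with hμ
  set B : Fin N → ℝ := OscillatorChain.bathWeight N with hB
  set J : PhaseSpace N → ℝ := fun z => ∑ k : Fin N, P.bondCurrent N k z with hJ
  set v : PhaseSpace N → ℝ := partialP b u with hv
  haveI : IsFiniteMeasure μ := isFiniteMeasure_gibbsWeight hω hl hβ γ N hT
  -- the contact carries a bath
  have hB1 : 1 ≤ B b := by
    simp only [hB]
    unfold OscillatorChain.bathWeight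
    rcases hb with h | h
    · rw [if_pos h]; split_ifs <;> norm_num
    · rw [if_pos h]; split_ifs <;> norm_num
  have hBn : ∀ i, 0 ≤ B i := fun i => Corrector.bathWeight_nonneg N i
  have hbw : 0 < B b := lt_of_lt_of_le one_pos hB1
  -- smoothness
  have hu3 : ContDiff ℝ 3 u := hu.of_le (by norm_cast)
  have hu2c : ContDiff ℝ 2 u := hu.of_le (by norm_cast)
  have hv2c : ContDiff ℝ 2 v := contDiff_partialP hu3 (m := 2) (by norm_num) b
  have hJs : ContDiff ℝ ∞ J := contDiff_totalBondCurrent ω₂ lam β γ N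
  have hJc : Continuous J := continuous_totalBondCurrent ω₂ lam β γ N
  have hU2 : ContDiff ℝ 2 P.U := pinnedChain_contDiff_U ω₂ lam β γ
  have hV2 : ContDiff ℝ 2 P.V := pinnedChain_contDiff_V ω₂ lam β γ
  -- the source of the commuted Poisson equation
  set k : PhaseSpace N → ℝ := fun x => partialP b J x + partialQ b u x - γ * B b * v x with hk
  have hkc : Continuous k :=
    ((continuous_partialP hJs (by simp) b).add (continuous_partialQ hu (by simp) b)).sub
      (continuous_const.mul (continuous_partialP hu (by simp) b))
  have hpdev : ∀ x, P.generator N T T v x = -k x := by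
    intro x
    have h1 := partialP_generator P hU2 hV2 hu3 T b x
    have eLu : P.generator N T T u = fun y => -J y := funext hpde
    rw [eLu, partialP_neg_apply] at h1
    have hγ' : P.γ = γ := rfl
    rw [hγ'] at h1
    simp only [hk]
    linarith
  -- `L²` bookkeeping (Gibbs measure `π_T` versus Gibbs weight `μ_T`)
  have hϑ : 0 < 1 / (4 * T) := by positivity
  have h2ϑ : 2 * (1 / (4 * T)) < 1 / T := by
    rw [show 2 * (1 / (4 * T)) = 1 / (2 * T) by field_simp; ring, div_lt_div_iff₀ (by positivity) hT]
    nlinarith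
  obtain ⟨M, -, hJM⟩ := abs_totalBondCurrent_le_exp hω.le hl hβ γ N hϑ
  have hJ2π : MemLp J 2 (P.gibbsMeasure N T) := memLp_two_of_abs_le_exp hω hl hβ hT γ hJc h2ϑ hJM
  have hu2π : MemLp u 2 (P.gibbsMeasure N T) := memLp_gibbsMeasure_of_gibbsWeight hω hl hβ γ N hT hu2
  have hqu2π : MemLp (partialQ b u) 2 (P.gibbsMeasure N T) :=
    memLp_gibbsMeasure_of_gibbsWeight hω hl hβ γ N hT hqu2
  have hdJ2π : MemLp (partialP b J) 2 (P.gibbsMeasure N T) :=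
    memLp_gibbsMeasure_of_gibbsWeight hω hl hβ γ N hT hdJ2
  have hv2π : MemLp v 2 (P.gibbsMeasure N T) :=
    memLp_partialP_of_poisson hω hl hβ hγ hT hu2c hu2π hJ2π hpde hbw
  have hv2 : MemLp v 2 μ := memLp_gibbsWeight_of_gibbsMeasure hω hl hβ γ N hT hv2π
  have hk2π : MemLp k 2 (P.gibbsMeasure N T) := (hdJ2π.add hqu2π).sub (hv2π.const_mul (γ * B b))
  -- the tap energy identity for `(v, k)` and finite entropy production of `v`
  have hD := integral_mul_source_eq_dirichlet hω hl hβ hγ hT hv2c hv2π hkc hk2π hpdev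
  have hdv2π : MemLp (partialP b v) 2 (P.gibbsMeasure N T) :=
    memLp_partialP_of_poisson hω hl hβ hγ hT hv2c hv2π hk2π hpdev hbw
  have hdv2 : MemLp (partialP b v) 2 μ := memLp_gibbsWeight_of_gibbsMeasure hω hl hβ γ N hT hdv2π
  refine ⟨hdv2, ?_⟩
  -- rewrite the identity against `μ_T`
  have hρ : ∀ f : PhaseSpace N → ℝ, ∫ x, f x ∂μ = ∫ x, f x * P.gibbsDensity N T x := fun f =>
    gaussIBP_integral_gibbsWeight ω₂ lam β γ N T f
  have hD' : ∫ x, v x * k x ∂μ = γ * T * ∑ i, B i * ∫ x, partialP i v x ^ 2 ∂μ := by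
    rw [hρ]
    simp only [hρ]
    exact hD
  -- split `∫ v k dμ_T`
  have hI1 : Integrable (fun x => v x * partialP b J x) μ := hv2.integrable_mul hdJ2
  have hI2 : Integrable (fun x => v x * partialQ b u x) μ := hv2.integrable_mul hqu2
  have hI3 : Integrable (fun x => v x * v x) μ := hv2.integrable_mul hv2
  have hI12 : Integrable (fun x => v x * partialP b J x + v x * partialQ b u x) μ := hI1.add hI2
  have hI3' : Integrable (fun x => γ * B b * (v x * v x)) μ := hI3.const_mul _
  have hsplit : ∫ x, v x * k x ∂μ =
      ((∫ x, v x * partialP b J x ∂μ) + ∫ x, v x * partialQ b u x ∂μ) - γ * B b * ∫ x, v x * v x ∂μ := by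
    have e : (fun x => v x * k x) =
        fun x => (v x * partialP b J x + v x * partialQ b u x) - γ * B b * (v x * v x) := by
      funext x; simp only [hk]; ring
    rw [e, integral_sub hI12 hI3', integral_add hI1 hI2, integral_const_mul]
  -- drop the nonnegative terms
  have hIn : ∀ i, 0 ≤ ∫ x, partialP i v x ^ 2 ∂μ := fun i => integral_nonneg fun x => sq_nonneg _
  have hle : ∫ x, partialP b v x ^ 2 ∂μ ≤ ∑ i, B i * ∫ x, partialP i v x ^ 2 ∂μ :=
    calc ∫ x, partialP b v x ^ 2 ∂μ ≤ B b * ∫ x, partialP b v x ^ 2 ∂μ := le_mul_of_one_le_left (hIn b) hB1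
      _ ≤ ∑ i, B i * ∫ x, partialP i v x ^ 2 ∂μ :=
        Finset.single_le_sum (f := fun i => B i * ∫ x, partialP i v x ^ 2 ∂μ)
          (fun i _ => mul_nonneg (hBn i) (hIn i)) (Finset.mem_univ b)
  have hvv : 0 ≤ ∫ x, v x * v x ∂μ := integral_nonneg fun x => mul_self_nonneg _
  have hγT : 0 ≤ γ * T := by positivity
  have hdrop : 0 ≤ γ * B b * ∫ x, v x * v x ∂μ := mul_nonneg (mul_nonneg hγ.le (hBn b)) hvv
  calc γ * T * ∫ x, partialP b v x ^ 2 ∂μ ≤ γ * T * ∑ i, B i * ∫ x, partialP i v x ^ 2 ∂μ :=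
        mul_le_mul_of_nonneg_left hle hγT
    _ = ∫ x, v x * k x ∂μ := hD'.symm
    _ = ((∫ x, v x * partialP b J x ∂μ) + ∫ x, v x * partialQ b u x ∂μ) - γ * B b * ∫ x, v x * v x ∂μ := hsplit
    _ ≤ (∫ x, v x * partialP b J x ∂μ) + ∫ x, v x * partialQ b u x ∂μ := sub_le_self _ hdrop

end Massive

/-- **Registered stub `stub_massiveTap` of line `SketchIdeator2`** (= `massiveTap` with its parameters
explicit): the fixed-`N` massive tap identity of card friction-mass-tap-resolvent as an inequality,
`∂²_{p_b} u ∈ L²(μ_T)` and `γ T ‖∂²_{p_b} u‖² ≤ ⟨∂_{p_b} u, ∂_{p_b} J⟩ + ⟨∂_{p_b} u, ∂_{q_b} u⟩`. [folklore] -/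
theorem stub_massiveTap : ∀ {ω₂ lam β γ : ℝ}, 0 < ω₂ → 0 ≤ lam → 0 ≤ β → 0 < γ → ∀ {T : ℝ}, 0 < T →
    ∀ {N : ℕ} (b : Fin N), (b.val = 0 ∨ b.val = N - 1) → ∀ {u : PhaseSpace N → ℝ}, ContDiff ℝ ∞ u →
    (∀ x, (pinnedChain ω₂ lam β γ).generator N T T u x =
      -(∑ k : Fin N, (pinnedChain ω₂ lam β γ).bondCurrent N k x)) →
    MemLp u 2 (gibbsWeight ω₂ lam β γ N T) →
    MemLp (partialQ b u) 2 (gibbsWeight ω₂ lam β γ N T) →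
    MemLp (partialP b (fun z : PhaseSpace N => ∑ k : Fin N, (pinnedChain ω₂ lam β γ).bondCurrent N k z)) 2
      (gibbsWeight ω₂ lam β γ N T) →
    MemLp (partialP b (partialP b u)) 2 (gibbsWeight ω₂ lam β γ N T) ∧
    γ * T * ∫ x, (partialP b (partialP b u) x) ^ 2 ∂(gibbsWeight ω₂ lam β γ N T) ≤
      (∫ x, partialP b u x *
          partialP b (fun z : PhaseSpace N => ∑ k : Fin N, (pinnedChain ω₂ lam β γ).bondCurrent N k z) x
          ∂(gibbsWeight ω₂ lam β γ N T)) +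
        ∫ x, partialP b u x * partialQ b u x ∂(gibbsWeight ω₂ lam β γ N T) := by
  intro ω₂ lam β γ hω hl hβ hγ T hT N b hb u hu hpde hu2 hqu2 hdJ2
  exact massiveTap hω hl hβ hγ hT b hb hu hpde hu2 hqu2 hdJ2

end Summit.AtomisticToContinuum.FouriersLaw.Theorems.OddSectorIrreversibility.TapLeak

end
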